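import Summits.AtomisticToContinuum.FouriersLaw.Theorems.BondHeatUncertaintyBoundedResponseBathHeatLogWindowB
import HarnessLib

/-!
# BondHeatUncertainty / BoundedResponse — «LogWindow» §11: the canonical RELAXATION TIME `ρ_N` of the boundary kernel, the MIXING HORIZON
`τ^mix_N = N³·ρ_N·(1 + log ρ_N)`, and ★★★ THE MIXING DOOR with ONE open piece (part 3 of 4 — overview in the main file `…BathHeatLogWindow`)

Objects: `relaxTimeSet` (admissible `ρ ≥ 1`: `|K_N(r)| ≤ 2T²·e^{1−r/ρ}` for `r ≥ 0`), `relaxTime = sInf relaxTimeSet + 1`, `mixingHorizon`.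
Facts: `one_le_relaxTime`; `mem_relaxTimeSet_of_expBound` (any exponential bound gives an admissible time); ★ `relaxTimeSet_nonempty` /
`relaxTime_mem` — FROM THE TREE's per-`N` exponential mixing (`boundaryKernelBasics_proof` (d) ⟵ `CuneoEckmannHairerReyBellet2018_thm213`, checked;
constants not explicit in `N`, and nothing about their growth is claimed); `remainder_floor_of_mem_relaxTimeSet`; ★★ `horizonRemainderFloorAt_mixingHorizon`
(`(HZᶠ[τ^mix]_1)` is a TREE THEOREM: the remainder piece of NODE 112 disappears at the mixing horizon); the route Prop `HorizonReturnMonotoneMixing a`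
(confined monotonicity of `𝔊^{aN,cN²;τ^mix_N}_N` on the log-mixing window `16T·log ρ_N + 80T·log N + 16T·log(1+log ρ_N) + 8T`; UNDECIDED ·
INSTRUMENTABLE only with a numerical proxy for `ρ_N` · IDEA-NEEDED · phonon-TRUE; not a literature fact); ★★★ `lateTailFloor_one_of_mixing :
0 ≤ a → HorizonReturnMonotoneMixing a → LateTailFloor a 1 1`; `boundedResponse_of_subdiffusiveBondHeat_mixing` (with (S), the blocker 11071); the
instrumentable feeders `horizonReturnMonotoneMixing_of_kinKickProfile_monoOn` / `_mono`. No `sorry`, no new axioms.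
-/

noncomputable section

open MeasureTheory ProbabilityTheory Filter Topology Set Function
open scoped NNReal ENNReal
open Literature.MathematicalPhysics.KineticTheory.HeatConduction
open Literature.MathematicalPhysics.KineticTheory OscillatorChain
open Literature.Probability.Process
open Summit.AtomisticToContinuum.FouriersLaw.Theorems.SubdiffusiveBondHeat (boundaryKernelBasics_proof)

namespace Summit.AtomisticToContinuum.FouriersLaw.Theorems.BoundedResponse.HeatSpreading

/-! ## §11 (NODE 113) The canonical RELAXATION TIME of the boundary kernel, the MIXING HORIZON, and the ONE-PIECE door -/

section Mixing

variable {ω₂ lam β γ T : ℝ}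

/-- **The admissible exponential relaxation times** of the boundary kinetic autocorrelation `K_N = bathKinCorr` at temperature `T`:
`ρ ≥ 1` with `|K_N(r)| ≤ 2T²·e^{1 − r/ρ}` for all `r ≥ 0` (`2T² = Var_{μ_T}(p₀²)` is the sharp sup bound, tree `BoundaryKernelBasics` (c)).
Upward closed; NONEMPTY for every `N ≥ 1` by the tree's per-`N` exponential mixing (`relaxTimeSet_nonempty`). [this cell; NEW object] -/
def relaxTimeSet (ω₂ lam β γ T : ℝ) (N : ℕ) : Set ℝ :=
  {ρ : ℝ | 1 ≤ ρ ∧ ∀ r : ℝ, 0 ≤ r → |bathKinCorr ω₂ lam β γ T N r| ≤ 2 * T ^ 2 * Real.exp (1 - r / ρ)}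

/-- ★ **THE RELAXATION TIME `ρ_N := inf(relaxTimeSet) + 1` OF THE BOUNDARY KERNEL** — a CANONICAL parameter-dependent sequence, finite and
admissible for every `N ≥ 1` (`relaxTime_mem`), with NO CLAIM WHATSOEVER on its growth in `N`: the tree decides nothing about it
(`FixedLengthNoConductivityControl`), `(KD_p)` of NODE 112 says `ρ_N = O(N^p·log N)`, diffusive phonon kinetics predicts `ρ_N ≍ N²…N³`.
It is the ONE number through which ergodicity enters NODE 113's mixing door, and only inside a logarithm. [this cell; NEW object] -/
def relaxTime (ω₂ lam β γ T : ℝ) (N : ℕ) : ℝ :=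
  sInf (relaxTimeSet ω₂ lam β γ T N) + 1

/-- **THE MIXING HORIZON `τ^mix_N := N³·ρ_N·(1 + log ρ_N)`** (superquadratic; `e^{−τ^mix_N/ρ_N} = e^{−N³}·ρ_N^{−N³}`). [this cell; NEW object] -/
def mixingHorizon (ω₂ lam β γ T : ℝ) (N : ℕ) : ℝ :=
  (N : ℝ) ^ 3 * (relaxTime ω₂ lam β γ T N * (1 + Real.log (relaxTime ω₂ lam β γ T N)))

/-- `relaxTimeSet_bddBelow` (docstring added by the landing lane; see the module docstring). [formal bookkeeping] -/
theorem relaxTimeSet_bddBelow (ω₂ lam β γ T : ℝ) (N : ℕ) : BddBelow (relaxTimeSet ω₂ lam β γ T N) :=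
  ⟨1, fun _ hx => hx.1⟩

/-- `ρ_N ≥ 1` (unconditionally). [formal bookkeeping] -/
theorem one_le_relaxTime (ω₂ lam β γ T : ℝ) (N : ℕ) : 1 ≤ relaxTime ω₂ lam β γ T N := by
  unfold relaxTime
  have : 0 ≤ sInf (relaxTimeSet ω₂ lam β γ T N) := Real.sInf_nonneg fun x hx => zero_le_one.trans hx.1
  linarith

/-- Minimality: `ρ_N ≤ ρ + 1` for every admissible `ρ`. [formal bookkeeping] -/
theorem relaxTime_le_of_mem {N : ℕ} {ρ : ℝ} (hρ : ρ ∈ relaxTimeSet ω₂ lam β γ T N) : relaxTime ω₂ lam β γ T N ≤ ρ + 1 := by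
  unfold relaxTime
  linarith [csInf_le (relaxTimeSet_bddBelow ω₂ lam β γ T N) hρ]

/-- Upward closure of the admissible set. [formal bookkeeping] -/
theorem mem_relaxTimeSet_of_le {N : ℕ} {ρ ρ' : ℝ} (hρ : ρ ∈ relaxTimeSet ω₂ lam β γ T N) (hle : ρ ≤ ρ') :
    ρ' ∈ relaxTimeSet ω₂ lam β γ T N := by
  refine ⟨hρ.1.trans hle, fun r hr => (hρ.2 r hr).trans ?_⟩
  have hρ0 : 0 < ρ := zero_lt_one.trans_le hρ.1
  have hT2 : 0 ≤ 2 * T ^ 2 := by positivity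
  refine mul_le_mul_of_nonneg_left (Real.exp_le_exp.2 ?_) hT2
  have : r / ρ' ≤ r / ρ := div_le_div_of_nonneg_left hr hρ0 hle
  linarith

/-- **From ANY exponential bound, an admissible relaxation time** (`N` fixed, `T > 0`): if `|K_N| ≤ 2T²` (tree (c)) and `|K_N(r)| ≤ C'·e^{−c'r}` for
`r ≥ 0` (`c' > 0`), then `ρ := max 1 ((2/c')·max 1 (log C' − log(2T²) − 1)) ∈ relaxTimeSet` (inside one relaxation time the trivial bound,
beyond it half the rate absorbs the prefactor). [elementary] -/
theorem mem_relaxTimeSet_of_expBound (hT : 0 < T) {N : ℕ} (hKb : ∀ r : ℝ, |bathKinCorr ω₂ lam β γ T N r| ≤ 2 * T ^ 2) {C' c' : ℝ}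
    (hc' : 0 < c') (hK : ∀ r : ℝ, 0 ≤ r → |bathKinCorr ω₂ lam β γ T N r| ≤ C' * Real.exp (-c' * r)) :
    max 1 (2 / c' * max 1 (Real.log C' - Real.log (2 * T ^ 2) - 1)) ∈ relaxTimeSet ω₂ lam β γ T N := by
  have hc'0 : c' ≠ 0 := hc'.ne'
  obtain ⟨L, hL⟩ : ∃ x : ℝ, x = Real.log C' - Real.log (2 * T ^ 2) - 1 := ⟨_, rfl⟩
  obtain ⟨ρ, hρ⟩ : ∃ x : ℝ, x = max 1 (2 / c' * max 1 L) := ⟨_, rfl⟩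
  rw [← hL, ← hρ]
  have hρ1 : 1 ≤ ρ := hρ ▸ le_max_left _ _
  have hρ0 : 0 < ρ := zero_lt_one.trans_le hρ1
  have h2c : 0 ≤ 2 / c' := by positivity
  have hρc : 2 ≤ ρ * c' := by
    have h1 : 2 / c' * 1 ≤ ρ := by
      rw [hρ]; exact le_trans (mul_le_mul_of_nonneg_left (le_max_left _ _) h2c) (le_max_right _ _)
    have h2 := mul_le_mul_of_nonneg_right h1 hc'.le
    rwa [mul_one, div_mul_cancel₀ _ hc'0] at h2
  have hρL : 2 * L ≤ ρ * c' := by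
    have h1 : 2 / c' * L ≤ ρ := by
      rw [hρ]; exact le_trans (mul_le_mul_of_nonneg_left (le_max_right _ _) h2c) (le_max_right _ _)
    have h2 := mul_le_mul_of_nonneg_right h1 hc'.le
    have h3 : 2 / c' * L * c' = 2 * L := by
      rw [show 2 / c' * L * c' = 2 / c' * c' * L by ring, div_mul_cancel₀ _ hc'0]
    linarith
  have h2T : 0 < 2 * T ^ 2 := by positivity
  refine ⟨hρ1, fun r hr => ?_⟩
  rcases le_or_gt r ρ with hrρ | hrρ
  · -- inside one relaxation time the trivial bound suffices
    have h1 : (1 : ℝ) ≤ Real.exp (1 - r / ρ) := by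
      have : 0 ≤ 1 - r / ρ := by rw [sub_nonneg, div_le_one hρ0]; exact hrρ
      calc (1 : ℝ) = Real.exp 0 := Real.exp_zero.symm
        _ ≤ Real.exp (1 - r / ρ) := Real.exp_le_exp.2 this
    calc |bathKinCorr ω₂ lam β γ T N r| ≤ 2 * T ^ 2 := hKb r
      _ = 2 * T ^ 2 * 1 := (mul_one _).symm
      _ ≤ 2 * T ^ 2 * Real.exp (1 - r / ρ) := mul_le_mul_of_nonneg_left h1 h2T.le
  · rcases le_or_gt C' 0 with hC' | hC'
    · calc |bathKinCorr ω₂ lam β γ T N r| ≤ C' * Real.exp (-c' * r) := hK r hr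
        _ ≤ 0 := mul_nonpos_of_nonpos_of_nonneg hC' (Real.exp_pos _).le
        _ ≤ 2 * T ^ 2 * Real.exp (1 - r / ρ) := by positivity
    · have hlhs : C' * Real.exp (-c' * r) = Real.exp (Real.log C' - c' * r) := by
        rw [sub_eq_add_neg, Real.exp_add, Real.exp_log hC', neg_mul]
      have hrhs : 2 * T ^ 2 * Real.exp (1 - r / ρ) = Real.exp (Real.log (2 * T ^ 2) + (1 - r / ρ)) := by
        rw [Real.exp_add, Real.exp_log h2T]
      have hdiv : r / ρ ≤ r * c' / 2 := by
        rw [div_le_iff₀ hρ0]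
        nlinarith [mul_nonneg hr (sub_nonneg.2 hρc)]
      have hLr : 2 * L ≤ r * c' := hρL.trans (by nlinarith)
      calc |bathKinCorr ω₂ lam β γ T N r| ≤ C' * Real.exp (-c' * r) := hK r hr
        _ = Real.exp (Real.log C' - c' * r) := hlhs
        _ ≤ Real.exp (Real.log (2 * T ^ 2) + (1 - r / ρ)) := by
            rw [Real.exp_le_exp]
            linarith
        _ = 2 * T ^ 2 * Real.exp (1 - r / ρ) := hrhs.symm

/-- ★ **NONEMPTY — the tree's per-`N` exponential mixing** (`N ≥ 1`, positive parameters): the boundary kernel admits an exponential relaxation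
time.  Source chain (all CHECKED): `boundaryKernelBasics_proof` (d) ⟵ `pinnedChain_kinCorr_exp_decay` ⟵ `CuneoEckmannHairerReyBellet2018_thm213`
(spectral gap of the pinned anharmonic chain at FIXED `N`; constants not explicit in `N`). [tree] -/
theorem relaxTimeSet_nonempty (hω : 0 < ω₂) (hl : 0 < lam) (hβ : 0 < β) (hγ : 0 < γ) (hT : 0 < T) {N : ℕ} (hN : 0 < N) :
    (relaxTimeSet ω₂ lam β γ T N).Nonempty := by
  obtain ⟨-, hKb, -⟩ := bathKinCorr_basics hω hl hβ hγ hT hN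
  obtain ⟨-, -, -, ⟨C', c', hc', hK⟩, -⟩ := boundaryKernelBasics_proof ω₂ lam β γ hω hl hβ hγ T hT N hN
  have hK' : ∀ r : ℝ, 0 ≤ r → |bathKinCorr ω₂ lam β γ T N r| ≤ C' * Real.exp (-c' * r) := hK
  exact ⟨_, mem_relaxTimeSet_of_expBound hT hKb hc' hK'⟩

/-- ★ **THE RELAXATION TIME IS ADMISSIBLE** (`N ≥ 1`): `|K_N(r)| ≤ 2T²·e^{1 − r/ρ_N}` for all `r ≥ 0`. [this cell; from the tree's mixing] -/
theorem relaxTime_mem (hω : 0 < ω₂) (hl : 0 < lam) (hβ : 0 < β) (hγ : 0 < γ) (hT : 0 < T) {N : ℕ} (hN : 0 < N) :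
    relaxTime ω₂ lam β γ T N ∈ relaxTimeSet ω₂ lam β γ T N := by
  have hne := relaxTimeSet_nonempty hω hl hβ hγ hT hN
  obtain ⟨ρ, hρS, hρlt⟩ := exists_lt_of_csInf_lt hne (lt_add_one (sInf (relaxTimeSet ω₂ lam β γ T N)))
  exact mem_relaxTimeSet_of_le hρS hρlt.le

/-- **THE REMAINDER PAST A RELAXATION HORIZON IS FREE** (`N ≥ 1`, `ρ` admissible for `K_N`): at `τ := N³·ρ·(1 + log ρ)`,
`γ²N²·Rem_N(τ) ≥ −(2e·γ²T²)·N` (indeed `Rem_N(τ) ≥ −2eT²·e^{−N³}·ρ^{1−N³}`; NODE 112's `bathKinRem_ge_of_expDecay`). [this cell] -/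
theorem remainder_floor_of_mem_relaxTimeSet (hω : 0 < ω₂) (hl : 0 < lam) (hβ : 0 < β) (hγ : 0 < γ) (hT : 0 < T) {N : ℕ}
    (hN : 0 < N) {ρ : ℝ} (hρ : ρ ∈ relaxTimeSet ω₂ lam β γ T N) :
    -(2 * Real.exp 1 * γ ^ 2 * T ^ 2 * (N : ℝ)) ≤
      γ ^ 2 * (N : ℝ) ^ 2 * bathKinRem ω₂ lam β γ T N ((N : ℝ) ^ 3 * (ρ * (1 + Real.log ρ))) := by
  have hρ1 := hρ.1
  have hρ0 : 0 < ρ := zero_lt_one.trans_le hρ1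
  have hρne : ρ ≠ 0 := hρ0.ne'
  have hlog : 0 ≤ Real.log ρ := Real.log_nonneg hρ1
  have hN1 : (1 : ℝ) ≤ N := by exact_mod_cast hN
  have hN0 : (0 : ℝ) < N := by linarith
  obtain ⟨τ, hτ⟩ : ∃ x : ℝ, x = (N : ℝ) ^ 3 * (ρ * (1 + Real.log ρ)) := ⟨_, rfl⟩
  rw [← hτ]
  have hτ0 : 0 ≤ τ := by rw [hτ]; positivity
  -- the admissible bound in the form `D·e^{−κ r}`, `D = 2T²e`, `κ = 1/ρ`
  have hκ : 0 < 1 / ρ := by positivity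
  have hK : ∀ r : ℝ, τ < r → |bathKinCorr ω₂ lam β γ T N r| ≤ (2 * T ^ 2 * Real.exp 1) * Real.exp (-(1 / ρ) * r) := by
    intro r hr
    have h := hρ.2 r (hτ0.trans hr.le)
    have e : 2 * T ^ 2 * Real.exp (1 - r / ρ) = (2 * T ^ 2 * Real.exp 1) * Real.exp (-(1 / ρ) * r) := by
      rw [sub_eq_add_neg, Real.exp_add]
      have : -(r / ρ) = -(1 / ρ) * r := by ring
      rw [this]; ring
    rwa [e] at h
  have hRem := bathKinRem_ge_of_expDecay hω hl hβ hγ hT hN hκ hτ0 hK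
  -- evaluate `e^{−τ/ρ} = e^{−N³}·e^{−N³ log ρ}`
  have hexp : Real.exp (-(1 / ρ) * τ) = Real.exp (-(N : ℝ) ^ 3) * Real.exp (-((N : ℝ) ^ 3 * Real.log ρ)) := by
    rw [← Real.exp_add, hτ]
    congr 1
    field_simp
    ring
  have h1 : ρ * Real.exp (-((N : ℝ) ^ 3 * Real.log ρ)) ≤ 1 := by
    have e : ρ * Real.exp (-((N : ℝ) ^ 3 * Real.log ρ)) = Real.exp ((1 - (N : ℝ) ^ 3) * Real.log ρ) := by
      rw [sub_mul, one_mul, sub_eq_add_neg, Real.exp_add, Real.exp_log hρ0]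
    rw [e, Real.exp_le_one_iff]
    have h3 : (1 : ℝ) ≤ (N : ℝ) ^ 3 := one_le_pow₀ hN1
    nlinarith
  have h2 : (N : ℝ) ^ 2 * Real.exp (-(N : ℝ) ^ 3) ≤ N := by
    have h3 : (N : ℝ) ≤ Real.exp ((N : ℝ) ^ 3) :=
      le_trans (le_self_pow₀ hN1 three_ne_zero) (by linarith [Real.add_one_le_exp ((N : ℝ) ^ 3)])
    rw [Real.exp_neg]
    calc (N : ℝ) ^ 2 * (Real.exp ((N : ℝ) ^ 3))⁻¹ ≤ (N : ℝ) ^ 2 * (N : ℝ)⁻¹ :=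
          mul_le_mul_of_nonneg_left (inv_anti₀ hN0 h3) (sq_nonneg _)
      _ = N := by rw [sq, mul_assoc, mul_inv_cancel₀ hN0.ne', mul_one]
  have hE0 : 0 ≤ (N : ℝ) ^ 2 * Real.exp (-(N : ℝ) ^ 3) := by positivity
  have hEF : ((N : ℝ) ^ 2 * Real.exp (-(N : ℝ) ^ 3)) * (ρ * Real.exp (-((N : ℝ) ^ 3 * Real.log ρ))) ≤ N :=
    le_trans (mul_le_of_le_one_right hE0 h1) h2
  have hX0 : 0 ≤ γ ^ 2 * (2 * T ^ 2 * Real.exp 1) := by positivity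
  have key : γ ^ 2 * (N : ℝ) ^ 2 * (-((2 * T ^ 2 * Real.exp 1) / (1 / ρ) * Real.exp (-(1 / ρ) * τ)))
      = -(γ ^ 2 * (2 * T ^ 2 * Real.exp 1) * (((N : ℝ) ^ 2 * Real.exp (-(N : ℝ) ^ 3)) * (ρ * Real.exp (-((N : ℝ) ^ 3 * Real.log ρ))))) := by
    rw [hexp]
    field_simp
  calc -(2 * Real.exp 1 * γ ^ 2 * T ^ 2 * (N : ℝ)) = -(γ ^ 2 * (2 * T ^ 2 * Real.exp 1) * N) := by ring
    _ ≤ -(γ ^ 2 * (2 * T ^ 2 * Real.exp 1) *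
          (((N : ℝ) ^ 2 * Real.exp (-(N : ℝ) ^ 3)) * (ρ * Real.exp (-((N : ℝ) ^ 3 * Real.log ρ))))) :=
        neg_le_neg (mul_le_mul_of_nonneg_left hEF hX0)
    _ = γ ^ 2 * (N : ℝ) ^ 2 * (-((2 * T ^ 2 * Real.exp 1) / (1 / ρ) * Real.exp (-(1 / ρ) * τ))) := key.symm
    _ ≤ γ ^ 2 * (N : ℝ) ^ 2 * bathKinRem ω₂ lam β γ T N τ := mul_le_mul_of_nonneg_left hRem (by positivity)

/-- ★★ **`(HZᶠ[τ^mix]_g)` IS A TREE THEOREM at every grade `g ≥ 1`**: the horizon-remainder piece of NODE 112 DISAPPEARS at the mixing horizon.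
Per-`N` ergodicity (non-uniform, CEHR 2018) is enough — the `N`-dependence of the mixing constants has been moved INTO the horizon, where it costs
only `log`. [this cell; NEW] -/
theorem horizonRemainderFloorAt_mixingHorizon :
    ∀ ω₂ lam β γ : ℝ, 0 < ω₂ → 0 < lam → 0 < β → 0 < γ → ∀ T : ℝ, 0 < T →
      ∃ C : ℝ, ∀ N : ℕ, 1 ≤ N → -(C * (N : ℝ)) ≤ γ ^ 2 * (N : ℝ) ^ 2 * bathKinRem ω₂ lam β γ T N (mixingHorizon ω₂ lam β γ T N) := by
  intro ω₂ lam β γ hω hl hβ hγ T hT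
  exact ⟨2 * Real.exp 1 * γ ^ 2 * T ^ 2, fun N hN =>
    remainder_floor_of_mem_relaxTimeSet hω hl hβ hγ hT hN (relaxTime_mem hω hl hβ hγ hT hN)⟩

/-- `τ^mix_N ≥ N³`. [formal bookkeeping] -/
theorem pow_three_le_mixingHorizon (ω₂ lam β γ T : ℝ) (N : ℕ) : (N : ℝ) ^ 3 ≤ mixingHorizon ω₂ lam β γ T N := by
  unfold mixingHorizon
  have h1 := one_le_relaxTime ω₂ lam β γ T N
  have hlog : 0 ≤ Real.log (relaxTime ω₂ lam β γ T N) := Real.log_nonneg h1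
  have : (1 : ℝ) ≤ relaxTime ω₂ lam β γ T N * (1 + Real.log (relaxTime ω₂ lam β γ T N)) :=
    one_le_mul_of_one_le_of_one_le h1 (by linarith)
  calc (N : ℝ) ^ 3 = (N : ℝ) ^ 3 * 1 := (mul_one _).symm
    _ ≤ _ := mul_le_mul_of_nonneg_left this (by positivity)

/-- **(HMmix_a) `HorizonReturnMonotoneMixing a`** — THE ONE OPEN PIECE OF NODE 113's MIXING DOOR: for all parameters and `c > 0`, eventually in
`N`, the heat-return curve at the MIXING HORIZON, `𝔊^{aN,cN²;τ^mix_N}_N`, is `ν_T`-a.e. nondecreasing in `k²` on the LOG-MIXING WINDOW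
`k² ≤ W_T(τ^mix; N) = 16T·log τ^mix_N + 32T·log N + 8T = 16T·log ρ_N + 80T·log N + 16T·log(1 + log ρ_N) + 8T`: «a boundary particle kicked
harder — but by at most `√(16·log ρ_N + 80·log N + 16·log(1 + log ρ_N) + 8)` thermal momenta — returns more late-weighted heat to the bath within
the mixing horizon».
WHY NOT 11071 AGAIN: it is a SHAPE statement about one response curve on a window of `O(log N + log ρ_N)` thermal energies, implied by confined
pointwise `(ER↑)` (NODE 110) and exactly true for phonons; it carries no `N`-uniform constant.  WHY IT MIGHT FAIL: hard-kick saturation INSIDE the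
window when `ρ_N` is huge (if `log ρ_N ≫ N`, the "window" covers kicks of energy `≫ NT` and the anharmonic on-site potential can drain them into
the bath before the chain stores them).  Tag: UNDECIDED · INSTRUMENTABLE only together with a numerical proxy for `ρ_N` · IDEA-NEEDED (phonon-TRUE).
[route statement · this cell; NOT a literature fact] -/
def HorizonReturnMonotoneMixing (a : ℝ) : Prop :=
  ∀ ω₂ lam β γ : ℝ, 0 < ω₂ → 0 < lam → 0 < β → 0 < γ → ∀ T : ℝ, 0 < T → ∀ c : ℝ, 0 < c →
    ∃ N₀ : ℕ, ∀ N : ℕ, N₀ ≤ N → ∃ R : ℝ → ℝ,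
      (∀ k₁ k₂ : ℝ, k₁ ^ 2 ≤ k₂ ^ 2 → k₂ ^ 2 ≤ logWindow (mixingHorizon ω₂ lam β γ T) T N → R k₁ ≤ R k₂) ∧
      horizonReturnProfile ω₂ lam β γ T N (a * (N : ℝ)) (c * (N : ℝ) ^ 2) (mixingHorizon ω₂ lam β γ T N) =ᵐ[gaussianReal 0 T.toNNReal] R

/-- ★★★ **THE MIXING DOOR OF NODE 113 — ONE OPEN PIECE** (`0 ≤ a`): `(HMmix_a) ⟹ LateTailFloor a 1 1`.
The ergodic content is DISCHARGED by the tree (per-`N` exponential mixing ⟹ `ρ_N < ∞` ⟹ the remainder past `τ^mix_N` is `O(e^{−N³})`); the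
confinement window pays for the unknown size of `ρ_N` at the rate of the LOG-WINDOW LAW.  No spectral-gap UNIFORMITY, no corrector budget, no
`(HZᶠ)` piece. [this cell; NEW] -/
theorem lateTailFloor_one_of_mixing {a : ℝ} (ha : 0 ≤ a) (hM : HorizonReturnMonotoneMixing a) : LateTailFloor a 1 1 := by
  intro ω₂ lam β γ hω hl hβ hγ T hT c hc
  obtain ⟨N₂, hN₂⟩ := hM ω₂ lam β γ hω hl hβ hγ T hT c hc
  obtain ⟨N₄, hN₄⟩ := exists_nat_ge (max c (2 * a))
  obtain ⟨C₁, hC₁⟩ := horizonRemainderFloorAt_mixingHorizon ω₂ lam β γ hω hl hβ hγ T hT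
  have hτ3 := pow_three_le_mixingHorizon ω₂ lam β γ T
  have hτ' : ∀ N : ℕ, max N₂ (max N₄ 1) ≤ N → c * (N : ℝ) ^ 2 ≤ mixingHorizon ω₂ lam β γ T N ∧
      2 * (a * N) ≤ mixingHorizon ω₂ lam β γ T N ∧ 1 ≤ mixingHorizon ω₂ lam β γ T N :=
    fun N hN => horizon_scales hτ3 hN₄ (le_trans (le_trans (le_max_left _ _) (le_max_right _ _)) hN)
      (le_trans (le_trans (le_max_right _ _) (le_max_right _ _)) hN)
  have hrem : ∀ N : ℕ, max N₂ (max N₄ 1) ≤ N →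
      -(C₁ * (N : ℝ)) ≤ γ ^ 2 * (N : ℝ) ^ 2 * bathKinRem ω₂ lam β γ T N (mixingHorizon ω₂ lam β γ T N) :=
    fun N hN => hC₁ N (le_trans (le_trans (le_max_right _ _) (le_max_right _ _)) hN)
  obtain ⟨C, hC⟩ := bathTailLate_floor_of_logWindow (τ := mixingHorizon ω₂ lam β γ T) hω hl hβ hγ hT ha hc hτ' hrem
    (fun N hN => hN₂ N (le_trans (le_max_left _ _) hN))
  refine ⟨C, max (max N₂ (max N₄ 1)) 1, fun N hN => ?_⟩
  rw [Real.rpow_one]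
  exact hC N hN

/-- ★ **NODE 113's mixing door lands on the blocker**: `(S) ∧ (HMmix_a) ⟹ BoundedResponse` (stmt-11071), `0 ≤ a`. [this cell] -/
theorem boundedResponse_of_subdiffusiveBondHeat_mixing {a : ℝ} (ha : 0 ≤ a) (hS : Theses.BondHeatUncertainty.SubdiffusiveBondHeat)
    (hM : HorizonReturnMonotoneMixing a) : Theses.BondHeatUncertainty.BoundedResponse :=
  boundedResponse_of_subdiffusiveBondHeat_lateTailFloor ha le_rfl hS (lateTailFloor_one_of_mixing ha hM)

/-- ★ **`(HMmix_a)` ⟸ CONFINED pointwise `(ER↑)` within the mixing horizon and the log-mixing window** (instrumentable form, census KICK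
readouts `Ḡ_{N,u}(k)`): eventually, for `aN < u ≤ τ^mix_N` and `k₁² ≤ k₂² ≤ W_T(τ^mix;N)`, `Ḡ_{N,u}(k₁) ≤ Ḡ_{N,u}(k₂)`. [this cell] -/
theorem horizonReturnMonotoneMixing_of_kinKickProfile_monoOn {a : ℝ} (ha : 0 ≤ a)
    (h : ∀ ω₂ lam β γ : ℝ, 0 < ω₂ → 0 < lam → 0 < β → 0 < γ → ∀ T : ℝ, 0 < T →
      ∃ N₀ : ℕ, ∀ N : ℕ, N₀ ≤ N → ∀ u : ℝ, a * N < u → u ≤ mixingHorizon ω₂ lam β γ T N → ∀ k₁ k₂ : ℝ, k₁ ^ 2 ≤ k₂ ^ 2 →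
        k₂ ^ 2 ≤ logWindow (mixingHorizon ω₂ lam β γ T) T N →
          kinKickProfile ω₂ lam β γ T N u k₁ ≤ kinKickProfile ω₂ lam β γ T N u k₂) :
    HorizonReturnMonotoneMixing a := by
  intro ω₂ lam β γ hω hl hβ hγ T hT c hc
  obtain ⟨N₀, hN₀⟩ := h ω₂ lam β γ hω hl hβ hγ T hT
  refine ⟨N₀ + ⌈2 * a / c⌉₊ + 1, fun N hN => ⟨_, fun k₁ k₂ hk hX => ?_, Eventually.of_forall fun k => rfl⟩⟩
  obtain ⟨n, rfl⟩ : ∃ n, N = n + 1 := ⟨N - 1, by omega⟩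
  have hs : 0 ≤ a * ((n + 1 : ℕ) : ℝ) := by positivity
  have hNc : 2 * a / c ≤ ((n + 1 : ℕ) : ℝ) :=
    (Nat.le_ceil _).trans (by exact_mod_cast (show ⌈2 * a / c⌉₊ ≤ n + 1 by omega))
  have hst : 2 * (a * ((n + 1 : ℕ) : ℝ)) ≤ c * ((n + 1 : ℕ) : ℝ) ^ 2 := by
    have hN0 : (0 : ℝ) ≤ ((n + 1 : ℕ) : ℝ) := by positivity
    have h2 : 2 * a ≤ ((n + 1 : ℕ) : ℝ) * c := by rwa [div_le_iff₀ hc] at hNc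
    nlinarith
  exact horizonReturnProfile_monoOn_of_kinKickProfile_monoOn hω hl hβ hγ hT n hs hst
    (fun u hu huτ k₁' k₂' hk' hX' => hN₀ (n + 1) (by omega) u hu huτ k₁' k₂' hk' hX') k₁ k₂ hk hX

/-- In particular NODE 110's UNCONFINED energy-monotonicity past the blind window (every lag `u > aN`, every kick) gives `(HMmix_a)` — by a route
that, unlike NODE 111's `(HR↑_a)`, never leaves finite horizons. [this cell] -/
theorem horizonReturnMonotoneMixing_of_kinKickProfile_mono {a : ℝ} (ha : 0 ≤ a)
    (h : ∀ ω₂ lam β γ : ℝ, 0 < ω₂ → 0 < lam → 0 < β → 0 < γ → ∀ T : ℝ, 0 < T →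
      ∃ N₀ : ℕ, ∀ N : ℕ, N₀ ≤ N → ∀ u : ℝ, a * N < u → ∀ k₁ k₂ : ℝ, k₁ ^ 2 ≤ k₂ ^ 2 →
        kinKickProfile ω₂ lam β γ T N u k₁ ≤ kinKickProfile ω₂ lam β γ T N u k₂) :
    HorizonReturnMonotoneMixing a :=
  horizonReturnMonotoneMixing_of_kinKickProfile_monoOn ha fun ω₂ lam β γ hω hl hβ hγ T hT => by
    obtain ⟨N₀, hN₀⟩ := h ω₂ lam β γ hω hl hβ hγ T hT
    exact ⟨N₀, fun N hN u hu _ k₁ k₂ hk _ => hN₀ N hN u hu k₁ k₂ hk⟩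

end Mixing

end Summit.AtomisticToContinuum.FouriersLaw.Theorems.BoundedResponse.HeatSpreading

end
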